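import Literature.AnabelianGeometry.EtaleTheta.ThetaCoversTempered
import Literature.AnabelianGeometry.EtaleTheta.TemperedCoverings
import HarnessLib

/-!
# [EtTh] Prop. 2.4: the `Y`-clause and the characteristic subgroups `Π^tp_{Y̲}`, `Π^tp_{Ÿ̲}` of `Π^tp_{X̲̲}`

Mochizuki, *The étale theta function and its Frobenioid-theoretic manifestations*, Publ. RIMS **45**
(2009), §2, Prop. 2.4 (PRIMS PDF pp. 38–39) [cite: MochizukiEtTh2009, Prop 2.4 p.38]; consumed by
[IUTchII] Prop. 2.1 (kurims p. 65: the top row `Π^tp_{Ÿ̲_v} ⊆ Π^tp_{Y̲_v} ⊆ Π^tp_{X̲̲_v}` "may be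
reconstructed … from `Π^tp_{X̲̲_v}`").

Cell abc-iut (D-0067 wave 4, seat abc-iut-w4-d034; GAP-LEDGER row G-w4d010-3). Proof-only companion
of abc-iut-L2-t2's `ThetaCoversTempered.lean` (interface `ThetaCovers.TemperedCoverData`, named fact
`TemperedCoverData.Prop24`) and of `TemperedCoverings.lean` (`IsTopCharacteristic`, [EtTh] Def. 3.3 (i));
nothing there is edited, no definition and no new named fact is introduced here.

The printed stabiliser lists of Prop. 2.4 contain `Π^tp` of `X̲̲, X̲, X, C̲̲, C̲, Ÿ` but NOT of `Y`
(review of p406952, recorded in `TemperedCoverData.tower`). This file supplies the missing step as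
GROUP THEORY and packages the outcome in the form the [IUTchII] consumer needs:

* `TemperedCoverData.map_PiYtp_eq_of_map_tp_PiX_of_map_PiYddtp` — **the `Y`-clause**: an automorphism
  `Γ` of the topological group `Π^tp_C` stabilising `Π^tp_X` and `Π^tp_Ÿ` stabilises `Π^tp_Y`. Proof:
  `Π^tp_Y ⊴ Π^tp_C` with `Π^tp_X/Π^tp_Y ≅ ℤ` (field `quotZ`) torsion-free and `[Π^tp_Y : Π^tp_Ÿ] = 2`
  (field `relIndex_PiYddtp`), so for `y ∈ Π^tp_Y` the square `y²` lies in `Π^tp_Ÿ`, whence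
  `Γ(y)² ∈ Π^tp_Ÿ ⊆ Π^tp_Y` with `Γ(y) ∈ Π^tp_X`, and an element of `Π^tp_X` whose square lies in
  `Π^tp_Y` lies in `Π^tp_Y` (`mem_PiYtp_of_mul_self_mem`); the same for `Γ⁻¹` gives equality.
* `TemperedCoverData.isTopCharacteristic_PiYddtp_subgroupOf_of_prop24`,
  `TemperedCoverData.isTopCharacteristic_PiYtp_subgroupOf_of_prop24` — from `T.Prop24` (clause (i), taken
  BY NAME as a hypothesis): `Π^tp_{Ÿ̲} := Π^tp_{X̲̲} ∩ Π^tp_Ÿ` and `Π^tp_{Y̲} := Π^tp_{X̲̲} ∩ Π^tp_Y` are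
  characteristic in the topological group `Π^tp_{X̲̲}` (every `γ ∈ Aut(Π^tp_{X̲̲})` extends to `Π^tp_C`
  stabilising `Π^tp_{X̲̲}`, `Π^tp_X`, `Π^tp_Ÿ`, hence `Π^tp_Y`).
* `IsTopCharacteristic.comap_continuousMulEquiv` — transport of characteristic subgroups along an
  isomorphism of topological groups (folklore), for the [IUTchII] Prop. 2.1 consumer
  (`Literature/IUT/HodgeArakelov/TemperedCoveringsCharacteristic.lean`).

Nothing here asserts that a `TemperedCoverData` exists or that `Prop24` holds; typed ≠ endorsed; no
side is taken on any disputed claim. Deliberately NOT here: the existence half of Prop. 2.4 (absolute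
anabelian geometry, the named fact itself), temp-slimness / uniqueness (abc-iut-L2-t7's
`Discharge/Sec2Prop24Reduction.lean`), anything about `X̲`, `C̲`, `C̲̲`.
-/

namespace Literature.AnabelianGeometry.EtaleTheta

universe u

/-! ### Folklore: subgroups stable under a family of automorphisms closed under inverses -/

section Folklore

variable {G : Type u} [Group G] [TopologicalSpace G]

/-- If every isomorphism of topological groups `G ≃ₜ* G` maps `K` INTO itself, then every such
isomorphism maps `K` ONTO itself (apply the hypothesis to the inverse). [folklore] -/
private theorem Subgroup.map_continuousMulEquiv_eq_of_forall_le (K : Subgroup G)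
    (h : ∀ φ : G ≃ₜ* G, K.map φ.toMulEquiv.toMonoidHom ≤ K) (φ : G ≃ₜ* G) :
    K.map φ.toMulEquiv.toMonoidHom = K :=
  le_antisymm (h φ) fun x hx => ⟨φ.symm x, h φ.symm ⟨x, hx, rfl⟩, φ.apply_symm_apply x⟩

/-- A subgroup stable under `φ` is stable under `φ⁻¹`. [folklore] -/
private theorem Subgroup.map_continuousMulEquiv_symm_eq {K : Subgroup G} {φ : G ≃ₜ* G}
    (h : K.map φ.toMulEquiv.toMonoidHom = K) : K.map φ.symm.toMulEquiv.toMonoidHom = K := by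
  refine le_antisymm ?_ fun x hx => ⟨φ x, h ▸ ⟨x, hx, rfl⟩, φ.symm_apply_apply x⟩
  rintro _ ⟨k, hk, rfl⟩
  rw [← h] at hk
  obtain ⟨k', hk', rfl⟩ := hk
  change φ.symm (φ k') ∈ K
  rwa [φ.symm_apply_apply]

variable (G) in
/-- **Transport of characteristic subgroups** along an isomorphism of topological groups
`e : G ≃ₜ* G'`: the preimage of a characteristic subgroup of `G'` is characteristic in `G` (conjugate
an automorphism `φ` of `G` to the automorphism `e ∘ φ ∘ e⁻¹` of `G'`) — the sense in which the
"characteristic open subgroups" of [EtTh] Def. 3.3 (i) are intrinsic to the isomorphism class of the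
topological group. [cite: MochizukiEtTh2009, Def 3.3 p.72] -/
theorem IsTopCharacteristic.comap_continuousMulEquiv {G' : Type u} [Group G'] [TopologicalSpace G']
    {K : Subgroup G'} (hK : IsTopCharacteristic G' K) (e : G ≃ₜ* G') :
    IsTopCharacteristic G (K.comap e.toMulEquiv.toMonoidHom) := by
  refine Subgroup.map_continuousMulEquiv_eq_of_forall_le _ fun φ => ?_
  rintro _ ⟨y, hy, rfl⟩
  change e (φ y) ∈ K
  have hψ := hK (e.symm.trans (φ.trans e))
  rw [← hψ]
  refine ⟨e y, hy, ?_⟩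
  change (e.symm.trans (φ.trans e)) (e y) = e (φ y)
  rw [ContinuousMulEquiv.trans_apply, ContinuousMulEquiv.trans_apply,
    ContinuousMulEquiv.symm_apply_apply]

end Folklore

namespace ThetaCovers

namespace TemperedCoverData

variable {l : ℕ} (T : TemperedCoverData.{u} l)

/-! ### The `Y`-clause of Prop. 2.4 is group theory -/

/-- `Π^tp_Y ⊆ Π^tp_X` (field `PiYtp_le`, restated with `tp`). [cite: MochizukiEtTh2009, Prop 2.4 p.38] -/
theorem PiYtp_le_tp_PiX : T.PiYtp ≤ T.tp T.PiX := T.PiYtp_le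

/-- `Π^tp_Ÿ ⊆ Π^tp_X`. [cite: MochizukiEtTh2009, Prop 2.4 p.38] -/
theorem PiYddtp_le_tp_PiX : T.PiYddtp ≤ T.tp T.PiX := T.PiYddtp_le.trans T.PiYtp_le

/-- Since `[Π^tp_Y : Π^tp_Ÿ] = 2`, the square of an element of `Π^tp_Y` lies in `Π^tp_Ÿ`.
[cite: MochizukiEtTh2009, Prop 2.4 p.38] -/
theorem mul_self_mem_PiYddtp {y : T.Gtp} (hy : y ∈ T.PiYtp) : y * y ∈ T.PiYddtp := by
  have h2 : (T.PiYddtp.subgroupOf T.PiYtp).index = 2 := T.relIndex_PiYddtp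
  have h := Subgroup.mul_self_mem_of_index_two h2 ⟨y, hy⟩
  rw [Subgroup.mem_subgroupOf] at h
  exact h

/-- Since `Π^tp_X/Π^tp_Y ≅ ℤ` is torsion-free, an element of `Π^tp_X` whose square lies in `Π^tp_Y`
lies in `Π^tp_Y`. [cite: MochizukiEtTh2009, Prop 2.4 p.38] -/
theorem mem_PiYtp_of_mul_self_mem {x : T.Gtp} (hx : x ∈ T.tp T.PiX) (h2 : x * x ∈ T.PiYtp) :
    x ∈ T.PiYtp := by
  obtain ⟨q⟩ := T.quotZ
  haveI : T.PiYtp.Normal := T.PiYtp_normal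
  have hx' : x ∈ T.PiX.comap T.toHat := hx
  set x' : ↥(T.PiX.comap T.toHat) := ⟨x, hx'⟩ with hx'def
  -- the class of `x` in `Π^tp_X/Π^tp_Y` squares to `1`
  have hsq : (QuotientGroup.mk (x' * x') :
      ↥(T.PiX.comap T.toHat) ⧸ T.PiYtp.subgroupOf (T.PiX.comap T.toHat)) = 1 := by
    rw [QuotientGroup.eq_one_iff, Subgroup.mem_subgroupOf]
    exact h2
  set z := q (QuotientGroup.mk x') with hzdef
  have hzz : z * z = 1 := by
    rw [hzdef, ← map_mul, ← QuotientGroup.mk_mul, hsq, map_one]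
  have hz0 : Multiplicative.toAdd z = 0 := by
    have h := congrArg Multiplicative.toAdd hzz
    rw [toAdd_mul, toAdd_one] at h
    omega
  have hz1 : z = 1 := Multiplicative.toAdd.injective (by rw [hz0, toAdd_one])
  have hmk : (QuotientGroup.mk x' :
      ↥(T.PiX.comap T.toHat) ⧸ T.PiYtp.subgroupOf (T.PiX.comap T.toHat)) = 1 :=
    (map_eq_one_iff q q.injective).mp hz1
  rw [QuotientGroup.eq_one_iff, Subgroup.mem_subgroupOf] at hmk
  exact hmk

/-- An automorphism of `Π^tp_C` stabilising `Π^tp_X` and `Π^tp_Ÿ` maps `Π^tp_Y` INTO itself.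
[cite: MochizukiEtTh2009, Prop 2.4 p.38] -/
theorem map_PiYtp_le_of_map_tp_PiX_of_map_PiYddtp (Γ : T.Gtp ≃ₜ* T.Gtp)
    (hX : (T.tp T.PiX).map Γ.toMulEquiv.toMonoidHom = T.tp T.PiX)
    (hYdd : T.PiYddtp.map Γ.toMulEquiv.toMonoidHom = T.PiYddtp) :
    T.PiYtp.map Γ.toMulEquiv.toMonoidHom ≤ T.PiYtp := by
  rintro _ ⟨y, hy, rfl⟩
  change Γ y ∈ T.PiYtp
  refine T.mem_PiYtp_of_mul_self_mem ?_ ?_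
  · rw [← hX]
    exact ⟨y, T.PiYtp_le_tp_PiX hy, rfl⟩
  · have h : Γ (y * y) ∈ T.PiYddtp := by
      rw [← hYdd]
      exact ⟨y * y, T.mul_self_mem_PiYddtp hy, rfl⟩
    rw [map_mul] at h
    exact T.PiYddtp_le h

/-- **The `Y`-clause of Prop. 2.4 is group theory**: an automorphism `Γ` of the topological group
`Π^tp_C` stabilising `Π^tp_X` and `Π^tp_Ÿ` stabilises `Π^tp_Y` (`Y` is not in the printed lists of
Prop. 2.4; this is why it need not be). [cite: MochizukiEtTh2009, Prop 2.4 p.38] -/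
theorem map_PiYtp_eq_of_map_tp_PiX_of_map_PiYddtp (Γ : T.Gtp ≃ₜ* T.Gtp)
    (hX : (T.tp T.PiX).map Γ.toMulEquiv.toMonoidHom = T.tp T.PiX)
    (hYdd : T.PiYddtp.map Γ.toMulEquiv.toMonoidHom = T.PiYddtp) :
    T.PiYtp.map Γ.toMulEquiv.toMonoidHom = T.PiYtp := by
  refine le_antisymm (T.map_PiYtp_le_of_map_tp_PiX_of_map_PiYddtp Γ hX hYdd) fun y hy => ?_
  have h' := T.map_PiYtp_le_of_map_tp_PiX_of_map_PiYddtp Γ.symm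
    (Subgroup.map_continuousMulEquiv_symm_eq hX) (Subgroup.map_continuousMulEquiv_symm_eq hYdd)
  exact ⟨Γ.symm y, h' ⟨y, hy, rfl⟩, Γ.apply_symm_apply y⟩

/-! ### From Prop. 2.4 (i): `Π^tp_{Ÿ̲}` and `Π^tp_{Y̲}` are characteristic in `Π^tp_{X̲̲}` -/

/-- The members `Π^tp_{X̲̲}`, `Π^tp_X`, `Π^tp_Ÿ` belong to the undotted tower of Prop. 2.4.
[cite: MochizukiEtTh2009, Prop 2.4 p.38] -/
theorem mem_tower_PiXuu_PiX_PiYddtp :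
    T.tp T.PiXuu ∈ T.tower ∧ T.tp T.PiX ∈ T.tower ∧ T.PiYddtp ∈ T.tower := by
  simp [tower]

/-- An automorphism `Γ` of `Π^tp_C` extending `γ ∈ Aut(Π^tp_Z)` and stabilising `K ⊆ Π^tp_C` makes
`γ` map `Π^tp_Z ∩ K` into itself. [folklore] -/
private theorem map_subgroupOf_le_of_extends {Z K : Subgroup T.Gtp} (γ : Z ≃ₜ* Z) (Γ : T.Gtp ≃ₜ* T.Gtp)
    (hΓ : ∀ z : Z, Γ z = γ z) (hK : K.map Γ.toMulEquiv.toMonoidHom = K) :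
    (K.subgroupOf Z).map γ.toMulEquiv.toMonoidHom ≤ K.subgroupOf Z := by
  rintro _ ⟨w, hw, rfl⟩
  have hw' : (w : T.Gtp) ∈ K := Subgroup.mem_subgroupOf.mp hw
  refine Subgroup.mem_subgroupOf.mpr ?_
  change ((γ w : Z) : T.Gtp) ∈ K
  rw [← hΓ w, ← hK]
  exact ⟨w, hw', rfl⟩

/-- **`Π^tp_{Ÿ̲} := Π^tp_{X̲̲} ∩ Π^tp_Ÿ` is characteristic in the topological group `Π^tp_{X̲̲}`**, granted
Prop. 2.4: every automorphism of `Π^tp_{X̲̲}` extends to `Π^tp_C` stabilising `Π^tp_{X̲̲}` and `Π^tp_Ÿ`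
(clause (i) of the named fact `Prop24`, taken as a hypothesis). [cite: MochizukiEtTh2009, Prop 2.4 p.38] -/
theorem isTopCharacteristic_PiYddtp_subgroupOf_of_prop24 (h : T.Prop24) :
    IsTopCharacteristic ↥(T.tp T.PiXuu) (T.PiYddtp.subgroupOf (T.tp T.PiXuu)) := by
  refine Subgroup.map_continuousMulEquiv_eq_of_forall_le _ fun γ => ?_
  obtain ⟨Γ, hΓ, hstab⟩ := h.1 γ
  exact T.map_subgroupOf_le_of_extends γ Γ hΓ (hstab _ T.mem_tower_PiXuu_PiX_PiYddtp.2.2)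

/-- **`Π^tp_{Y̲} := Π^tp_{X̲̲} ∩ Π^tp_Y` is characteristic in the topological group `Π^tp_{X̲̲}`**, granted
Prop. 2.4 (clause (i) of `Prop24` as a hypothesis): the extension stabilises `Π^tp_X` and `Π^tp_Ÿ`,
hence `Π^tp_Y` by the `Y`-clause. [cite: MochizukiEtTh2009, Prop 2.4 p.38] -/
theorem isTopCharacteristic_PiYtp_subgroupOf_of_prop24 (h : T.Prop24) :
    IsTopCharacteristic ↥(T.tp T.PiXuu) (T.PiYtp.subgroupOf (T.tp T.PiXuu)) := by
  refine Subgroup.map_continuousMulEquiv_eq_of_forall_le _ fun γ => ?_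
  obtain ⟨Γ, hΓ, hstab⟩ := h.1 γ
  exact T.map_subgroupOf_le_of_extends γ Γ hΓ
    (T.map_PiYtp_eq_of_map_tp_PiX_of_map_PiYddtp Γ
      (hstab _ T.mem_tower_PiXuu_PiX_PiYddtp.2.1) (hstab _ T.mem_tower_PiXuu_PiX_PiYddtp.2.2))

end TemperedCoverData

end ThetaCovers

end Literature.AnabelianGeometry.EtaleTheta
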